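import Summits.HodgeConjecture.HodgeConjecture.Theorems.F0P2rCuspDictHolds               -- ★ CUSP-DICT bricks; pulls ★ `F0P2rFamTransferHolds` (`isConstituentOf_of_isotypicComponent_eq_top`), ★ `F0P2cOmegaLocalType` (`isLocalTypeAt_rhoAtLine_chi`), ★ `F0P2cStubCI`, ★ `F0P3FinPartIsotypic`
import Summits.HodgeConjecture.HodgeConjecture.Theorems.F0P2oXThetaOwnClass                -- ★ K1c `isIrreducible_xThetaCM` ∕ `isSmooth_xThetaCM`
import Summits.HodgeConjecture.HodgeConjecture.Theorems.F0P2oThetaClassOfSupercuspidal     -- ★ `thetaTypeAtCM_comap_mk_piH`, `isSupercuspidal_comap_mk_piH`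
import Summits.HodgeConjecture.HodgeConjecture.Theorems.F0P3FinRepConstituentsExist         -- ★ `exists_comap_isConstituentOf_finRepSmooth_comp` (a v-constituent EXISTS)
import HarnessLib

/-!
# Crux `H413`, line LH10 «(D-b)ᵀ» — organ glue (TCᴸ): THE v-CONSTITUENTS OF A DISCRETE `P` WITH THETA FINITE COMPONENT `P_f ↩ ω_H(μ, a, χ)`
# exist, all EQUAL the theta class, are of theta type `X_v(μ, a, χ_f) ∘ κ_v⁻¹`, and are supercuspidal when `X_v(μ, a, χ_f)` is

Cell `hodgecm-mathlib` (D-0151), FLOOR 0, crux item H413 = `stmt-HodgeConjecture-24833`; squad F0∕P3c line LH10 (pay-down of the print letter (D-b)ᵀˢ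
★ `GelbartRogawski1991.piSCompletion_isThetaTypeAtCMTestSigned`), seat LH10-p02 (g0), DEAL «(O1-RED)» of LH10-plan (g0) 2026-09-02T02:45:18Z, item (f) of its
work list, cut as the ROAD-INDEPENDENT glue (variant (γ) of this seat's 02:52Z census): every in-house road to the organ (O1) `StubThetaLiftMember` of the
skeleton `F0/P3c/LH10/LH10-plan/g0/DbT.paydown.skeleton.v1.lean` that produces its discrete `P` through an occurrence `P.HasFinComponent (rhoAtLine … a χ)`
(★ S2♯-θ, ★ Θ-OCC-GEN) reads O1's two constituent clauses («`P` has a `v`-constituent», «every `v`-constituent is supercuspidal AND of theta type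
`X_v(μ, a, χ_f) ∘ κ_v⁻¹`») off THIS file.  THEOREMS ONLY (no `def`, no instance, no notation, no named fact, no `sorry`); no `Cruxes/**` import;
`--supports stmt-HodgeConjecture-24833`.  HONEST LABEL: HC_CM is proved only modulo the printed citations until rung 0 closes; nothing here proves a letter
(and nothing here touches the AUTOMORPHY GAP of the census: `χ : Chi` is automorphic by type).

CONTENT (frame `(H, e₁, dV, g, ιV)` with `ιV k = g_f⁻¹ k g_f`, automorphic measure `μA`, discrete `P`, conjugate-symplectic `μ`, line `a ∈ (L⁺)ˣ`, `χ : Chi`,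
occurrence `hfin : P.HasFinComponent (rhoAtLine … ιV a χ)`, ANY finite place `v` of `L⁺` — split or not):
* §1 `eq_thetaClass_of_isConstituentOf` — every `v`-constituent `c` of `P` (D6 currency: `comap (localPiEquiv v) c ∈ JH(P_f^∞ ∘ inclPlace v)`) IS the theta class
  `πθ := ⟦X_v(μ,a,χ_f) ∘ κ_v⁻¹⟧ ∘ localPiEquiv_v⁻¹` (the class of ★ `F0P2oThetaClassOfSupercuspidal`); this is the KEY step of ★ FILE 2
  `F0P2uMemXiFamilyThetaNonsplit.nonsplit_clause_of_hasFinComponent_theta` (its inline `hP`), exported: Flath + [Liu2021 Lem. D.1] make `P_f^∞` isotypic of the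
  IRREDUCIBLE admissible `ω_H(a)` (★ `isotypicComponent_finRep_smoothPart_eq_top`), whose restriction to the place `v` is isotypic of the irreducible local type
  `τ_a = X_v ∘ κ_v⁻¹` (★ `isLocalTypeAt_rhoAtLine_chi`), so every `v`-constituent is a constituent of `τ_a` (★ `isConstituentOf_of_isotypicComponent_eq_top`), i.e. equals its class;
  `eq_of_isConstituentOf` — hence any two `v`-constituents coincide.
* §2 `thetaTypeAtCM_of_isConstituentOf` — every `v`-constituent is of theta type (★ `thetaTypeAtCM_comap_mk_piH`); `isSupercuspidal_of_isConstituentOf` — and is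
  supercuspidal when `X_v(μ, a, χ_f)` is (★ `isSupercuspidal_comap_mk_piH`).
* §3 `exists_isConstituentOf_theta` — a `v`-constituent EXISTS (★ `exists_comap_isConstituentOf_finRepSmooth_comp` at the irreducible smooth `ω_H(a)`);
  `exists_and_forall_isConstituentOf_theta` — O1's two constituent clauses bundled, given supercuspidality of `X_v(μ, a, χ_f)`.

## References
* [GelbartRogawski1991] S. Gelbart, J. Rogawski, Invent. Math. 105 (1991): §3.4 Prop. 3.4.1 pp. 459–460, Thm. 3.4 (a) p. 461; §5.1 (5.1.1) p. 465, Lem. 5.1.2 p. 466.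
* [Rogawski1990] J. Rogawski, Ann. of Math. Stud. 123 (1990): §13.1 p. 199, Prop. 13.1.3 (d); §12.2 (2) p. 174.
* [Liu2021] Y. Liu, Camb. J. Math. 9 (2021): Def. 4.11 (l. 2090–2096); App. D §D.1, Lem. D.1 (1).  [Flath1979] D. Flath, PSPM 33.1: Thm. 3.
* [BushnellHenniart2006] C. Bushnell, G. Henniart, Grundlehren 335: §1.1, §2, §10.1.
-/

set_option autoImplicit false
-- the mandated namespace repeats the single-problem summit's segment (`HodgeConjecture.HodgeConjecture`)
set_option linter.dupNamespace false

noncomputable section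

open scoped Matrix Kronecker MatrixGroups MonoidAlgebra ComplexOrder
open NumberField NumberField.InfinitePlace IsDedekindDomain MeasureTheory
open Literature.NumberTheory Literature.NumberTheory.Automorphic Literature.NumberTheory.Automorphic.UnitaryGroup
open Literature.NumberTheory.Automorphic.Liu2021 Literature.NumberTheory.Automorphic.Liu2021.AppendixC
open Literature.NumberTheory.Automorphic.Liu2021.Def411WeilCarriers
open Literature.NumberTheory.Automorphic.Liu2021.Def411WeilCarriersDoubling
open Literature.NumberTheory.Automorphic.IdeleClassGroup
open Literature.NumberTheory.GelbartRogawski1991 Literature.NumberTheory.GelbartRogawski1991.UnitaryDualPair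
open Literature.NumberTheory.GelbartRogawski1991.UnitaryDualPair.WeilCoinv
open Literature.NumberTheory.GelbartRogawski1991.UnitaryDualPair.LocalSplitting
open Literature.RepresentationTheory Literature.RepresentationTheory.Liu2021
open Literature.NumberTheory.GaloisRepresentations Literature.RepresentationTheory.HarrisKudlaSweet1996
open Literature.NumberTheory.Rogawski1990
open Summit.HodgeConjecture.CorCM
open Summit.HodgeConjecture.CorCM.Transposition
open Summit.HodgeConjecture.HodgeConjecture.Cruxes.H413

namespace Summit.HodgeConjecture.HodgeConjecture.Cruxes.H413.F0P3cDbTThetaConstituents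

variable (L : Type) [Field L] [NumberField L] [IsCMField L] (H : Matrix (Fin 3) (Fin 3) L)
    {n' : ℕ} (e₁ : Fin 3 × Fin 1 ≃ Fin n') (dV : Fin 3 → L) (hdV : ∀ i, IsCMField.complexConj L (dV i) = dV i) (hdV0 : ∀ i, dV i ≠ 0)
    (g : GL (Fin 3) L)
    (hg : ((g : Matrix (Fin 3) (Fin 3) L).map (cmConjRingHom L))ᵀ * H * (g : Matrix (Fin 3) (Fin 3) L) = Matrix.diagonal dV)
    (ιV : finAdelic (↥(maximalRealSubfield L)) L (IsCMField.complexConj L) 3 H →*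
        finAdelic (↥(maximalRealSubfield L)) L (IsCMField.complexConj L) 3 (Matrix.diagonal dV))
    (hιV : ∀ k, ((ιV k : finAdelic (↥(maximalRealSubfield L)) L (IsCMField.complexConj L) 3 (Matrix.diagonal dV)) :
          GL (Fin 3) (FiniteAdeleRing (𝓞 L) L)) =
        (toFinAdeleGL L 3 g)⁻¹ * (k : GL (Fin 3) (FiniteAdeleRing (𝓞 L) L)) * toFinAdeleGL L 3 g)
    (μA : Measure (adelicGroupData (↥(maximalRealSubfield L)) L (IsCMField.complexConj L) 3 H).automorphicQuotient)
    [(adelicGroupData (↥(maximalRealSubfield L)) L (IsCMField.complexConj L) 3 H).IsAutomorphicMeasure μA]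
    (P : DiscreteAutomorphicRep (adelicGroupData (↥(maximalRealSubfield L)) L (IsCMField.complexConj L) 3 H) μA)
    (μ : Literature.NumberTheory.Automorphic.IdeleClassGroup L →ₜ* Circle) (hμ : IsConjugateSymplectic L μ)
    (a : (↥(maximalRealSubfield L))ˣ) (χ : Chi (↥(maximalRealSubfield L)) L (IsCMField.complexConj L))
    (hfin : P.HasFinComponent
      (rhoAtLine (↥(maximalRealSubfield L)) L (IsCMField.complexConj L) 3 e₁ (Matrix.diagonal dV)
        (complexConj_imagUnit L) (imagUnit_ne_zero L) (imagUnit_mul_self L) (realDiagonal_isSymm L dV hdV)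
        (isUnit_det_realDiagonal L dV hdV hdV0) (realDiagonal_map L dV hdV).symm
        (fun a => isCompatible_chiSplittingLine L e₁ dV hdV hdV0 (toHeckeCharacter L μ)
          (isUnitary_toHeckeCharacter L μ) ((isOscillatorChar_toHeckeCharacter_iff μ).mpr hμ)
          (TW (↥(maximalRealSubfield L)) a) (isSymm_TW (↥(maximalRealSubfield L)) a)
          (isUnit_det_TW (↥(maximalRealSubfield L)) a) (JW (↥(maximalRealSubfield L)) L a)
          (JW_eq (↥(maximalRealSubfield L)) L a)) ιV a χ))
    (v : HeightOneSpectrum (𝓞 ↥(maximalRealSubfield L)))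

include hg hιV hfin

/-! ## §1 Every `v`-constituent of `P` IS the theta class -/

set_option synthInstance.maxHeartbeats 400000 in
set_option maxHeartbeats 16000000 in
/-- **EVERY `v`-CONSTITUENT OF A THETA-TYPE `P` IS THE THETA CLASS** `⟦X_v(μ, a, χ_f) ∘ κ_v⁻¹⟧ ∘ localPiEquiv_v⁻¹` (exported KEY step of ★ FILE 2's `hP`): Flath +
[Liu2021 Lem. D.1 (1)] (★ `isotypicComponent_finRep_smoothPart_eq_top` at the irreducible admissible `ω_H(a)`, ★ `rhoAtLine_chi_isIrreducible∕_isAdmissible`), the local type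
of `ω_H(a)` at `v` (★ `isLocalTypeAt_rhoAtLine_chi`), inheritance of constituents (★ `IsConstituentOf.of_isotypicComponent_eq_top_comp`, ★
`isConstituentOf_of_isotypicComponent_eq_top`) and «a constituent of an irreducible is its class» (★ `IsConstituentOf.eq_of_isIrreducible`, ★ `comap_injective`).
[cite: Flath1979, Thm. 3] [cite: Liu2021, App. D Lem. D.1 (1); Def. 4.11 (l. 2090–2096)] [cite: BushnellHenniart2006, §1.1, §2] -/
theorem eq_thetaClass_of_isConstituentOf (c : IrrClass ((cmDatum L 3 H).Local v))
    (hc : (IrrClass.comap (localPiEquiv L (IsCMField.complexConj L) 3 H v) c).IsConstituentOf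
      (P.finRep.smoothPart.toRepresentation.comp (inclPlace (↥(maximalRealSubfield L)) L (IsCMField.complexConj L) 3 H v))) :
    c = IrrClass.comap (localPiEquiv L (IsCMField.complexConj L) 3 H v).symm
        (IrrClass.mk
          { V := _,
            ρ := ((xThetaCM L e₁ dV hdV hdV0 μ hμ χ.1 a v :
                  localPi L (IsCMField.complexConj L) 3 (Matrix.diagonal dV) v →* _).comp
                (localCongr L (IsCMField.complexConj L) g one_ne_zero
                  (by rw [one_smul]; exact hg) v).symm.toMulEquiv.toMonoidHom),
            isIrreducible := F0P2oThetaTypeOwnClass.isIrreducible_piH L H e₁ dV hdV hdV0 g hg μ hμ χ.1 a v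
              (F0P2oXThetaOwnClass.isIrreducible_xThetaCM L e₁ dV hdV hdV0 μ hμ χ.1 χ.2.1 (Def411WeilCarriers.norm_chi_eq_one_cm L χ) a v),
            isSmooth := F0P2oThetaTypeOwnClass.isSmooth_piH L H e₁ dV hdV hdV0 g hg μ hμ χ.1 a v
              (F0P2oXThetaOwnClass.isSmooth_xThetaCM L e₁ dV hdV hdV0 μ hμ χ.1 χ.2.1 (Def411WeilCarriers.norm_chi_eq_one_cm L χ) a v) }) := by
  have hirrρ := F0P2cStubCI.rhoAtLine_chi_isIrreducible L H e₁ dV hdV hdV0 g hg ιV hιV μ hμ a χ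
  have hadm := F0P2cStubCI.rhoAtLine_chi_isAdmissible L H e₁ dV hdV hdV0 g hg ιV hιV μ hμ a χ
  obtain ⟨hτ, hτtop⟩ := F0P2cOmegaLocalType.isLocalTypeAt_rhoAtLine_chi L H e₁ dV hdV hdV0 g hg ιV hιV μ hμ a χ v
  have htopP := F0P3FinPartIsotypic.isotypicComponent_finRep_smoothPart_eq_top P _ hirrρ hadm hfin
  haveI := hirrρ
  -- `c` read on `localPi v` is a constituent of the irreducible local type `τ_a`
  have h₁ := hc.of_isotypicComponent_eq_top_comp htopP (inclPlace (↥(maximalRealSubfield L)) L (IsCMField.complexConj L) 3 H v)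
  have h₂ := F0P2rFamTransferHolds.isConstituentOf_of_isotypicComponent_eq_top hτtop h₁
  -- the theta class read on `localPi v` is `⟦τ_a⟧` itself (★ `comap_comap_symm`), a constituent of `τ_a`
  set r : SmoothIrrep ↥(localPi L (IsCMField.complexConj L) 3 H v) :=
    { V := _,
      ρ := ((xThetaCM L e₁ dV hdV hdV0 μ hμ χ.1 a v :
            localPi L (IsCMField.complexConj L) 3 (Matrix.diagonal dV) v →* _).comp
          (localCongr L (IsCMField.complexConj L) g one_ne_zero
            (by rw [one_smul]; exact hg) v).symm.toMulEquiv.toMonoidHom),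
      isIrreducible := F0P2oThetaTypeOwnClass.isIrreducible_piH L H e₁ dV hdV hdV0 g hg μ hμ χ.1 a v
        (F0P2oXThetaOwnClass.isIrreducible_xThetaCM L e₁ dV hdV hdV0 μ hμ χ.1 χ.2.1 (Def411WeilCarriers.norm_chi_eq_one_cm L χ) a v),
      isSmooth := F0P2oThetaTypeOwnClass.isSmooth_piH L H e₁ dV hdV hdV0 g hg μ hμ χ.1 a v
        (F0P2oXThetaOwnClass.isSmooth_xThetaCM L e₁ dV hdV hdV0 μ hμ χ.1 χ.2.1 (Def411WeilCarriers.norm_chi_eq_one_cm L χ) a v) }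
    with hr_def
  have h₃ : (IrrClass.comap (localPiEquiv L (IsCMField.complexConj L) 3 H v)
      (IrrClass.comap (localPiEquiv L (IsCMField.complexConj L) 3 H v).symm (IrrClass.mk r))).IsConstituentOf r.ρ := by
    rw [IrrClass.comap_comap_symm]
    exact IrrClass.isConstituentOf_mk_self r
  haveI := hτ
  exact IrrClass.comap_injective (localPiEquiv L (IsCMField.complexConj L) 3 H v) (h₂.eq_of_isIrreducible h₃)

set_option synthInstance.maxHeartbeats 400000 in
set_option maxHeartbeats 16000000 in
/-- **Any two `v`-constituents of a theta-type `P` coincide** (both are the theta class, §1). [cite: Flath1979, Thm. 3] [cite: BushnellHenniart2006, §2] -/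
theorem eq_of_isConstituentOf (c c' : IrrClass ((cmDatum L 3 H).Local v))
    (hc : (IrrClass.comap (localPiEquiv L (IsCMField.complexConj L) 3 H v) c).IsConstituentOf
      (P.finRep.smoothPart.toRepresentation.comp (inclPlace (↥(maximalRealSubfield L)) L (IsCMField.complexConj L) 3 H v)))
    (hc' : (IrrClass.comap (localPiEquiv L (IsCMField.complexConj L) 3 H v) c').IsConstituentOf
      (P.finRep.smoothPart.toRepresentation.comp (inclPlace (↥(maximalRealSubfield L)) L (IsCMField.complexConj L) 3 H v))) :
    c = c' := by
  rw [eq_thetaClass_of_isConstituentOf L H e₁ dV hdV hdV0 g hg ιV hιV μA P μ hμ a χ hfin v c hc,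
    eq_thetaClass_of_isConstituentOf L H e₁ dV hdV hdV0 g hg ιV hιV μA P μ hμ a χ hfin v c' hc']

/-! ## §2 Every `v`-constituent is of theta type, and supercuspidal when `X_v` is -/

set_option synthInstance.maxHeartbeats 400000 in
set_option maxHeartbeats 16000000 in
/-- **EVERY `v`-CONSTITUENT OF A THETA-TYPE `P` IS OF THETA TYPE `X_v(μ, a, χ_f) ∘ κ_v⁻¹`** (★ `ThetaTypeAtCM`): §1 + ★ `thetaTypeAtCM_comap_mk_piH`.  «The local components
of the global Weil representation `ω(γ, ψ^a, χ)` are the local Weil representations» — O1's theta-type clause.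
[cite: GelbartRogawski1991, §3.4 Prop. 3.4.1 pp. 459–460; §5.1 (5.1.1) p. 465, Lem. 5.1.2 p. 466] [cite: Liu2021, Def. 4.11 (l. 2090–2096); App. D Lem. D.1 (1)] -/
theorem thetaTypeAtCM_of_isConstituentOf (c : IrrClass ((cmDatum L 3 H).Local v))
    (hc : (IrrClass.comap (localPiEquiv L (IsCMField.complexConj L) 3 H v) c).IsConstituentOf
      (P.finRep.smoothPart.toRepresentation.comp (inclPlace (↥(maximalRealSubfield L)) L (IsCMField.complexConj L) 3 H v))) :
    ThetaTypeAtCM L H e₁ dV hdV hdV0 g hg μ hμ χ.1 a v c := by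
  rw [eq_thetaClass_of_isConstituentOf L H e₁ dV hdV hdV0 g hg ιV hιV μA P μ hμ a χ hfin v c hc]
  exact F0P2oThetaClassOfSupercuspidal.thetaTypeAtCM_comap_mk_piH L H e₁ dV hdV hdV0 g hg μ hμ χ.1 a v
    (F0P2oXThetaOwnClass.isIrreducible_xThetaCM L e₁ dV hdV hdV0 μ hμ χ.1 χ.2.1 (Def411WeilCarriers.norm_chi_eq_one_cm L χ) a v)
    (F0P2oXThetaOwnClass.isSmooth_xThetaCM L e₁ dV hdV hdV0 μ hμ χ.1 χ.2.1 (Def411WeilCarriers.norm_chi_eq_one_cm L χ) a v)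

set_option synthInstance.maxHeartbeats 400000 in
set_option maxHeartbeats 16000000 in
/-- **EVERY `v`-CONSTITUENT OF A THETA-TYPE `P` IS SUPERCUSPIDAL WHEN `X_v(μ, a, χ_f)` IS** (§1 + ★ `isSupercuspidal_comap_mk_piH`) — O1's supercuspidality clause
for a line `a` in the supercuspidal class at `v` ([GelbartRogawski1991 §1.4]: «if `v` is finite then `πˢ(ϱ_v)` is supercuspidal»).
[cite: GelbartRogawski1991, §1.4 p. 451; Lem. 5.1.2 p. 466] [cite: BushnellHenniart2006, §10.1] -/
theorem isSupercuspidal_of_isConstituentOf (hsc : (xThetaCM L e₁ dV hdV hdV0 μ hμ χ.1 a v).IsSupercuspidal)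
    (c : IrrClass ((cmDatum L 3 H).Local v))
    (hc : (IrrClass.comap (localPiEquiv L (IsCMField.complexConj L) 3 H v) c).IsConstituentOf
      (P.finRep.smoothPart.toRepresentation.comp (inclPlace (↥(maximalRealSubfield L)) L (IsCMField.complexConj L) 3 H v))) :
    c.IsSupercuspidal := by
  rw [eq_thetaClass_of_isConstituentOf L H e₁ dV hdV hdV0 g hg ιV hιV μA P μ hμ a χ hfin v c hc]
  exact F0P2oThetaClassOfSupercuspidal.isSupercuspidal_comap_mk_piH L H e₁ dV hdV hdV0 g hg μ hμ χ.1 a v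
    (F0P2oXThetaOwnClass.isIrreducible_xThetaCM L e₁ dV hdV hdV0 μ hμ χ.1 χ.2.1 (Def411WeilCarriers.norm_chi_eq_one_cm L χ) a v)
    (F0P2oXThetaOwnClass.isSmooth_xThetaCM L e₁ dV hdV hdV0 μ hμ χ.1 χ.2.1 (Def411WeilCarriers.norm_chi_eq_one_cm L χ) a v) hsc

/-! ## §3 A `v`-constituent exists; O1's two constituent clauses bundled -/

set_option synthInstance.maxHeartbeats 400000 in
set_option maxHeartbeats 16000000 in
/-- **A THETA-TYPE `P` HAS A `v`-CONSTITUENT at every finite place** (★ `exists_comap_isConstituentOf_finRepSmooth_comp` at the irreducible (★ `rhoAtLine_chi_isIrreducible`)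
smooth (★ `rhoAtLine_chi_isSmoothRep`) finite component `ω_H(a)`). [cite: Flath1979, Thm. 3] [cite: BushnellHenniart2006, §2] -/
theorem exists_isConstituentOf_theta :
    ∃ c : IrrClass ((cmDatum L 3 H).Local v),
      (IrrClass.comap (localPiEquiv L (IsCMField.complexConj L) 3 H v) c).IsConstituentOf
        (P.finRep.smoothPart.toRepresentation.comp (inclPlace (↥(maximalRealSubfield L)) L (IsCMField.complexConj L) 3 H v)) := by
  have hirrρ := F0P2cStubCI.rhoAtLine_chi_isIrreducible L H e₁ dV hdV hdV0 g hg ιV hιV μ hμ a χ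
  have hsmρ := F0P2cStubCI.rhoAtLine_chi_isSmoothRep L H e₁ dV hdV hdV0 g hg ιV hιV μ hμ a χ
  obtain ⟨c, hc⟩ := F0P3FinRepConstituentsExist.exists_comap_isConstituentOf_finRepSmooth_comp P hirrρ
    (F0P2cStubCI.isSmooth_of_isSmoothRep _ hsmρ) hfin v
  exact ⟨c, hc⟩

set_option synthInstance.maxHeartbeats 400000 in
set_option maxHeartbeats 16000000 in
/-- **O1's two constituent clauses at once**: for a theta-type `P` whose line `a` lies in the supercuspidal class at `v` (`X_v(μ, a, χ_f)` supercuspidal), `P` has a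
`v`-constituent, and every `v`-constituent is supercuspidal and of theta type `X_v(μ, a, χ_f) ∘ κ_v⁻¹` — the shape of `StubThetaLiftMember`'s last two conjuncts.
[cite: GelbartRogawski1991, §3.4 Prop. 3.4.1 pp. 459–460, Thm. 3.4 (a) p. 461; Lem. 5.1.2 p. 466] [cite: Rogawski1990, §13.1 Prop. 13.1.3 (d) p. 199] -/
theorem exists_and_forall_isConstituentOf_theta (hsc : (xThetaCM L e₁ dV hdV hdV0 μ hμ χ.1 a v).IsSupercuspidal) :
    (∃ c : IrrClass ((cmDatum L 3 H).Local v),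
      (IrrClass.comap (localPiEquiv L (IsCMField.complexConj L) 3 H v) c).IsConstituentOf
        (P.finRep.smoothPart.toRepresentation.comp (inclPlace (↥(maximalRealSubfield L)) L (IsCMField.complexConj L) 3 H v))) ∧
    ∀ c : IrrClass ((cmDatum L 3 H).Local v),
      (IrrClass.comap (localPiEquiv L (IsCMField.complexConj L) 3 H v) c).IsConstituentOf
          (P.finRep.smoothPart.toRepresentation.comp (inclPlace (↥(maximalRealSubfield L)) L (IsCMField.complexConj L) 3 H v)) →
        c.IsSupercuspidal ∧ ThetaTypeAtCM L H e₁ dV hdV hdV0 g hg μ hμ χ.1 a v c :=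
  ⟨exists_isConstituentOf_theta L H e₁ dV hdV hdV0 g hg ιV hιV μA P μ hμ a χ hfin v,
    fun c hc => ⟨isSupercuspidal_of_isConstituentOf L H e₁ dV hdV hdV0 g hg ιV hιV μA P μ hμ a χ hfin v hsc c hc,
      thetaTypeAtCM_of_isConstituentOf L H e₁ dV hdV hdV0 g hg ιV hιV μA P μ hμ a χ hfin v c hc⟩⟩

end Summit.HodgeConjecture.HodgeConjecture.Cruxes.H413.F0P3cDbTThetaConstituents

end
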